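import Mathlib.LinearAlgebra.Matrix.SpecialLinearGroup
import Mathlib.LinearAlgebra.Matrix.Notation
import Mathlib.Data.ZMod.Basic
import Mathlib.GroupTheory.OrderOfElement
import Mathlib.SetTheory.Cardinal.Finite
import Literature.Combinatorics.Additive.TripleProductProperty
import Literature.Computability.AlgebraicComplexity.CohnUmansTPP
import Literature.Computability.AlgebraicComplexity.CohnUmansDihedralSubgroupTPP
import HarnessLib

/-!
# `SL₃(𝔽₂)` realizes `⟨8,7,7⟩` through three subgroups (Hedtke–Murthy 2012, Lemma 7.1)

Topic `Literature/Computability/AlgebraicComplexity` (group-theoretic matrix multiplication; companion of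
`CohnUmansTPP.lean` (`RealizesTPP`), `CohnUmansDihedralSubgroupTPP.lean` (`SubgroupTPP`, the subgroup form of the
triple product property) and `TPPCapacityIndexThree.lean` / `TPPCapacityIndexFour.lean` (Lemmas 4.1–4.2 of the same
paper)).

I. Hedtke, S. Murthy, *Search and test algorithms for triple product property triples*, Groups Complex.
Cryptol. 4 (2012), doi:10.1515/gcc-2012-0006 = arXiv:1104.5097, §7.3, Lemma 7.1 (held text
`paper:arxiv-1104.5097` chunk p0011 L34–36, proof L38–69), verbatim:

> **Lemma 7.1.** The finite special linear group `SL₃𝔽₂` realizes `⟨8,7,7⟩` via a TPP triple of subgroups, and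
> its TPP capacity has the lower bound `β(SL₃𝔽₂) ≥ 392 = (7/3)|SL₃𝔽₂|`.
> *Proof.* We write `G := SL₃𝔽₂` and define a proper subset `S ⊂ G` by
> `S := { [1 x y; 0 1 z; 0 0 1] | x, y, z ∈ 𝔽₂ }`. This is a subgroup of order `8`, consisting of all the upper
> unitriangular matrices in `G`. Define two proper cyclic subgroups `T, U < G` by `T := ⟨t₀ := [1 1 1; 1 0 0; 1 1 0]⟩`,
> `U := ⟨u₀ := [0 0 1; 1 0 1; 1 1 1]⟩`. The generators `t₀` and `u₀`, as defined above, have order `7` in `G`, so `T`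
> and `U` are cyclic of order `7`. We know that `T ∩ U = 1` […]. In `TU := {t₀ⁱu₀ʲ : i, j ∈ ℤ₇} ⊂ G` all nontrivial
> products `t₀ⁱu₀ʲ`, with `i, j ∈ ℤ₇` not both zero, are non-upper triangular matrices, and therefore
> `T, U, TU ⊆ (G ∖ S) ∪ 1`. Therefore, we have `S ∩ TU = 1`. Thus `(S,T,U)` is a (basic) TPP triple of subgroups
> of `G`, and by it `G` realizes `⟨8,7,7⟩` of size `8·7·7 = 392`. The TPP capacity `β(G)` is at least its TPP
> capacity via subgroups `β_g(G)`, which, by this result, is at least `392`. […] □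

## Formalization (all proved; `0 defs / 0 facts`)
`SL₃(𝔽₂)` is Mathlib's `Matrix.SpecialLinearGroup (Fin 3) (ZMod 2)`; the three sets are written exactly as printed —
`S` = the image of `(x,y,z) ↦ [1 x y; 0 1 z; 0 0 1]`, `T = {t₀ⁱ : i < 7}`, `U = {u₀ʲ : j < 7}` — as `let`-bound
terms in the statements (no definitions are introduced). The finitely many matrix identities of the printed proof
(orders of `t₀, u₀`; `T ∩ U = 1`; "every nontrivial `t₀ⁱu₀ʲ` is not upper triangular"; `S, T, U` are closed under
products and inverses; `|S| = 8`, `|T| = |U| = 7`; `|SL₃(𝔽₂)| = 168`) are decided by the kernel (`decide +kernel`).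
The step "`S ∩ TU = 1` and `T ∩ U = 1` ⇒ TPP triple of subgroups" is the general lemma
`tripleProductProperty_of_mulClosed` (for carriers of subgroups the TPP reduces to the subgroup condition
`a b c = 1 ⇒ b = c = 1`, cf. `SubgroupTPP` and Cohn–Umans 2003, Def. 2.1, remark).

* `HedtkeMurthy2012_lemma71_orderOf` — `t₀` and `u₀` have order `7`.
* `HedtkeMurthy2012_lemma71_inter` — `T ∩ U = {1}`;  `HedtkeMurthy2012_lemma71_key` — `t₀ⁱ u₀ʲ` is upper
  (uni)triangular only for `t₀ⁱ = u₀ʲ = 1`.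
* `HedtkeMurthy2012_lemma71_triple` — `(S,T,U)` has the triple product property, `|S| = 8`, `|T| = |U| = 7`.
* `HedtkeMurthy2012_lemma71_subgroups` — there are subgroups `H₁, H₂, H₃ ≤ SL₃(𝔽₂)` of orders `8, 7, 7` with
  `SubgroupTPP H₁ H₂ H₃` ("via a TPP triple of subgroups").
* `HedtkeMurthy2012_lemma71` — `RealizesTPP SL₃(𝔽₂) 8 7 7`, `|SL₃(𝔽₂)| = 168` and `3·(8·7·7) = 7·|SL₃(𝔽₂)|`
  ("`392 = (7/3)|SL₃𝔽₂|`"; the TPP capacity `β` itself is not introduced in the tree — the statement is the realized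
  triple it bounds, as in `PseudoExponentBounds.lean`).

## References
* I. Hedtke, S. Murthy, arXiv:1104.5097 = Groups Complex. Cryptol. 4 (2012): §7.3, Lemma 7.1 with proof.
  [HedtkeMurthy2012]
* H. Cohn, C. Umans, FOCS 2003, arXiv:math/0307321: Def. 2.1 (triple product property; remark on subgroups).
  [CohnUmans2003]
-/

namespace Literature.Computability.AlgebraicComplexity

open Matrix Literature.Combinatorics.Additive Literature.Computability.AlgebraicComplexity.DihedralSubgroups

/-! ## Carriers of subgroups: the TPP reduces to `a b c = 1 ⇒ b = c = 1` -/

section General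

variable {G : Type*} [Group G]

/-- In a finite set in which every element has an inverse inside the set, inverses stay inside. [folklore] -/
private theorem inv_mem_of_exists_mul_eq_one {X : Finset G} (hX : ∀ x ∈ X, ∃ y ∈ X, x * y = 1) :
    ∀ x ∈ X, x⁻¹ ∈ X := by
  intro x hx
  obtain ⟨y, hy, hxy⟩ := hX x hx
  rw [inv_eq_of_mul_eq_one_right hxy]
  exact hy

/-- For three finite sets that are carriers of subgroups (closed under products, every element has an inverse in
the set) the triple product property follows from the subgroup condition "`a b c = 1` with `a ∈ S`, `b ∈ T`,
`c ∈ U` forces `b = c = 1`" (then also `a = 1`): the quotients `s s'⁻¹, t t'⁻¹, u u'⁻¹` lie in `S, T, U` again.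
This is the remark after Cohn–Umans' Def. 2.1 ("if the `Sᵢ` are subgroups … the condition simplifies"), cf.
`SubgroupTPP`. [cite: CohnUmans2003, Def. 2.1 (remark)] -/
theorem tripleProductProperty_of_mulClosed {S T U : Finset G}
    (hS : ∀ x ∈ S, ∀ y ∈ S, x * y ∈ S) (hS' : ∀ x ∈ S, ∃ y ∈ S, x * y = 1)
    (hT : ∀ x ∈ T, ∀ y ∈ T, x * y ∈ T) (hT' : ∀ x ∈ T, ∃ y ∈ T, x * y = 1)
    (hU : ∀ x ∈ U, ∀ y ∈ U, x * y ∈ U) (hU' : ∀ x ∈ U, ∃ y ∈ U, x * y = 1)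
    (h : ∀ a ∈ S, ∀ b ∈ T, ∀ c ∈ U, a * b * c = 1 → b = 1 ∧ c = 1) :
    TripleProductProperty S T U := by
  intro s hs s' hs' t ht t' ht' u hu u' hu' he
  have ha : s * s'⁻¹ ∈ S := hS _ hs _ (inv_mem_of_exists_mul_eq_one hS' _ hs')
  have hb : t * t'⁻¹ ∈ T := hT _ ht _ (inv_mem_of_exists_mul_eq_one hT' _ ht')
  have hc : u * u'⁻¹ ∈ U := hU _ hu _ (inv_mem_of_exists_mul_eq_one hU' _ hu')
  obtain ⟨h2, h3⟩ := h _ ha _ hb _ hc he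
  refine ⟨?_, mul_inv_eq_one.1 h2, mul_inv_eq_one.1 h3⟩
  rw [h2, h3, mul_one, mul_one] at he
  exact mul_inv_eq_one.1 he

/-- The same data give three `Subgroup`s with the prescribed carriers satisfying `SubgroupTPP`.
[cite: CohnUmans2003, Def. 2.1 (remark)] -/
theorem exists_subgroupTPP_of_mulClosed {S T U : Finset G}
    (h1S : (1 : G) ∈ S) (hS : ∀ x ∈ S, ∀ y ∈ S, x * y ∈ S) (hS' : ∀ x ∈ S, ∃ y ∈ S, x * y = 1)
    (h1T : (1 : G) ∈ T) (hT : ∀ x ∈ T, ∀ y ∈ T, x * y ∈ T) (hT' : ∀ x ∈ T, ∃ y ∈ T, x * y = 1)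
    (h1U : (1 : G) ∈ U) (hU : ∀ x ∈ U, ∀ y ∈ U, x * y ∈ U) (hU' : ∀ x ∈ U, ∃ y ∈ U, x * y = 1)
    (h : ∀ a ∈ S, ∀ b ∈ T, ∀ c ∈ U, a * b * c = 1 → b = 1 ∧ c = 1) :
    ∃ H₁ H₂ H₃ : Subgroup G, (H₁ : Set G) = S ∧ (H₂ : Set G) = T ∧ (H₃ : Set G) = U ∧
      SubgroupTPP H₁ H₂ H₃ := by
  refine ⟨{ carrier := S, mul_mem' := fun hx hy => hS _ hx _ hy, one_mem' := h1S,
            inv_mem' := fun hx => inv_mem_of_exists_mul_eq_one hS' _ hx },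
          { carrier := T, mul_mem' := fun hx hy => hT _ hx _ hy, one_mem' := h1T,
            inv_mem' := fun hx => inv_mem_of_exists_mul_eq_one hT' _ hx },
          { carrier := U, mul_mem' := fun hx hy => hU _ hx _ hy, one_mem' := h1U,
            inv_mem' := fun hx => inv_mem_of_exists_mul_eq_one hU' _ hx },
          rfl, rfl, rfl, ?_⟩
  intro a ha b hb c hc habc
  obtain ⟨h2, h3⟩ := h a ha b hb c hc habc
  refine ⟨?_, h2, h3⟩
  rwa [h2, h3, mul_one, mul_one] at habc

end General

/-! ## The computations in `SL₃(𝔽₂)` -/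

section SL3F2

open scoped MatrixGroups

/-- "The generators `t₀` and `u₀` … have order `7` in `G`": `t₀⁷ = u₀⁷ = 1`, `t₀, u₀ ≠ 1` (kernel computation).
[cite: HedtkeMurthy2012, Lemma 7.1 (proof)] -/
private theorem pow_seven :
    let t : SL(3, ZMod 2) := ⟨!![1, 1, 1; 1, 0, 0; 1, 1, 0], by decide⟩
    let u : SL(3, ZMod 2) := ⟨!![0, 0, 1; 1, 0, 1; 1, 1, 1], by decide⟩
    (t ^ 7 = 1 ∧ t ≠ 1) ∧ (u ^ 7 = 1 ∧ u ≠ 1) := by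
  decide +kernel

/-- **Hedtke–Murthy 2012, Lemma 7.1 (proof, step 1)**: `t₀ = [1 1 1; 1 0 0; 1 1 0]` and `u₀ = [0 0 1; 1 0 1; 1 1 1]`
have order `7` in `SL₃(𝔽₂)` ("so `T` and `U` are cyclic of order `7`"). [cite: HedtkeMurthy2012, Lemma 7.1 (proof)] -/
theorem HedtkeMurthy2012_lemma71_orderOf :
    let t : SL(3, ZMod 2) := ⟨!![1, 1, 1; 1, 0, 0; 1, 1, 0], by decide⟩
    let u : SL(3, ZMod 2) := ⟨!![0, 0, 1; 1, 0, 1; 1, 1, 1], by decide⟩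
    orderOf t = 7 ∧ orderOf u = 7 := by
  intro t u
  have h := pow_seven
  haveI : Fact (Nat.Prime 7) := ⟨by decide⟩
  exact ⟨orderOf_eq_prime_iff.mpr h.1, orderOf_eq_prime_iff.mpr h.2⟩

/-- **Hedtke–Murthy 2012, Lemma 7.1 (proof, step 2a)**: "`T ∩ U = 1`" for `T = {t₀ⁱ : i < 7}`, `U = {u₀ʲ : j < 7}`
(kernel computation). [cite: HedtkeMurthy2012, Lemma 7.1 (proof)] -/
theorem HedtkeMurthy2012_lemma71_inter :
    let t : SL(3, ZMod 2) := ⟨!![1, 1, 1; 1, 0, 0; 1, 1, 0], by decide⟩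
    let u : SL(3, ZMod 2) := ⟨!![0, 0, 1; 1, 0, 1; 1, 1, 1], by decide⟩
    (Finset.range 7).image (t ^ ·) ∩ (Finset.range 7).image (u ^ ·) = {1} := by
  decide +kernel

/-- **Hedtke–Murthy 2012, Lemma 7.1 (proof, step 2b)**, the computation "all nontrivial products `t₀ⁱu₀ʲ`, with
`i, j` not both zero, are non-upper triangular matrices" (hence "`S ∩ TU = 1`"), stated as: if `b c` (`b ∈ T`,
`c ∈ U`) has zero entries below the diagonal then `b = c = 1` (kernel computation over the `49` pairs).
[cite: HedtkeMurthy2012, Lemma 7.1 (proof)] -/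
theorem HedtkeMurthy2012_lemma71_key :
    let t : SL(3, ZMod 2) := ⟨!![1, 1, 1; 1, 0, 0; 1, 1, 0], by decide⟩
    let u : SL(3, ZMod 2) := ⟨!![0, 0, 1; 1, 0, 1; 1, 1, 1], by decide⟩
    ∀ b ∈ (Finset.range 7).image (t ^ ·), ∀ c ∈ (Finset.range 7).image (u ^ ·),
      ((b * c) 1 0 = 0 ∧ (b * c) 2 0 = 0 ∧ (b * c) 2 1 = 0) → b = 1 ∧ c = 1 := by
  decide +kernel

/-- Carrier facts for `S` = the upper unitriangular matrices (kernel computation): `|S| = 8`, `1 ∈ S`, `S` is closed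
under products, every element has an inverse in `S` ("a subgroup of order `8`"), and every element of `S` has zero
entries below the diagonal. [cite: HedtkeMurthy2012, Lemma 7.1 (proof)] -/
private theorem facts_S :
    let s : ZMod 2 × ZMod 2 × ZMod 2 → SL(3, ZMod 2) := fun p =>
      ⟨!![1, p.1, p.2.1; 0, 1, p.2.2; 0, 0, 1], by simp [Matrix.det_fin_three]⟩
    (Finset.univ.image s).card = 8 ∧ (1 : SL(3, ZMod 2)) ∈ Finset.univ.image s ∧
    (∀ x ∈ Finset.univ.image s, ∀ y ∈ Finset.univ.image s, x * y ∈ Finset.univ.image s) ∧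
    (∀ x ∈ Finset.univ.image s, ∃ y ∈ Finset.univ.image s, x * y = 1) ∧
    (∀ a ∈ Finset.univ.image s, a 1 0 = 0 ∧ a 2 0 = 0 ∧ a 2 1 = 0) := by
  decide +kernel

/-- Carrier facts for `T = {t₀ⁱ : i < 7}` (kernel computation): `|T| = 7`, `1 ∈ T`, closed under products, inverses
inside ("cyclic of order `7`"). [cite: HedtkeMurthy2012, Lemma 7.1 (proof)] -/
private theorem facts_T :
    let t : SL(3, ZMod 2) := ⟨!![1, 1, 1; 1, 0, 0; 1, 1, 0], by decide⟩
    ((Finset.range 7).image (t ^ ·)).card = 7 ∧ (1 : SL(3, ZMod 2)) ∈ (Finset.range 7).image (t ^ ·) ∧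
    (∀ x ∈ (Finset.range 7).image (t ^ ·), ∀ y ∈ (Finset.range 7).image (t ^ ·),
      x * y ∈ (Finset.range 7).image (t ^ ·)) ∧
    (∀ x ∈ (Finset.range 7).image (t ^ ·), ∃ y ∈ (Finset.range 7).image (t ^ ·), x * y = 1) := by
  decide +kernel

/-- Carrier facts for `U = {u₀ʲ : j < 7}` (kernel computation): `|U| = 7`, `1 ∈ U`, closed under products, inverses
inside ("cyclic of order `7`"). [cite: HedtkeMurthy2012, Lemma 7.1 (proof)] -/
private theorem facts_U :
    let u : SL(3, ZMod 2) := ⟨!![0, 0, 1; 1, 0, 1; 1, 1, 1], by decide⟩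
    ((Finset.range 7).image (u ^ ·)).card = 7 ∧ (1 : SL(3, ZMod 2)) ∈ (Finset.range 7).image (u ^ ·) ∧
    (∀ x ∈ (Finset.range 7).image (u ^ ·), ∀ y ∈ (Finset.range 7).image (u ^ ·),
      x * y ∈ (Finset.range 7).image (u ^ ·)) ∧
    (∀ x ∈ (Finset.range 7).image (u ^ ·), ∃ y ∈ (Finset.range 7).image (u ^ ·), x * y = 1) := by
  decide +kernel

/-- `|SL₃(𝔽₂)| = 168` (kernel count of the `3 × 3` matrices over `𝔽₂` of determinant `1`). [folklore] -/
private theorem card_SL3F2 : Fintype.card SL(3, ZMod 2) = 168 := by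
  decide +kernel

/-- **Hedtke–Murthy 2012, Lemma 7.1 (the triple, as printed)**: with `S` = the upper unitriangular matrices of
`SL₃(𝔽₂)`, `T = ⟨t₀⟩ = {t₀ⁱ : i < 7}`, `U = ⟨u₀⟩ = {u₀ʲ : j < 7}`, the triple `(S, T, U)` satisfies the triple
product property and `|S| = 8`, `|T| = |U| = 7`. Proof as printed: `a b c = 1` with `a ∈ S, b ∈ T, c ∈ U` gives
`b c = a⁻¹ ∈ S` upper unitriangular, so `b = c = 1` by `HedtkeMurthy2012_lemma71_key` ("`S ∩ TU = 1`",
"`T ∩ U = 1`"), and for subgroups this is the TPP (`tripleProductProperty_of_mulClosed`).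
[cite: HedtkeMurthy2012, Lemma 7.1] -/
theorem HedtkeMurthy2012_lemma71_triple :
    let s : ZMod 2 × ZMod 2 × ZMod 2 → SL(3, ZMod 2) := fun p =>
      ⟨!![1, p.1, p.2.1; 0, 1, p.2.2; 0, 0, 1], by simp [Matrix.det_fin_three]⟩
    let t : SL(3, ZMod 2) := ⟨!![1, 1, 1; 1, 0, 0; 1, 1, 0], by decide⟩
    let u : SL(3, ZMod 2) := ⟨!![0, 0, 1; 1, 0, 1; 1, 1, 1], by decide⟩
    TripleProductProperty (Finset.univ.image s) ((Finset.range 7).image (t ^ ·))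
        ((Finset.range 7).image (u ^ ·)) ∧
      (Finset.univ.image s).card = 8 ∧ ((Finset.range 7).image (t ^ ·)).card = 7 ∧
        ((Finset.range 7).image (u ^ ·)).card = 7 := by
  intro s t u
  obtain ⟨h8, -, hS, hS', hshape⟩ := facts_S
  obtain ⟨h7, -, hT, hT'⟩ := facts_T
  obtain ⟨h7', -, hU, hU'⟩ := facts_U
  have hkey := HedtkeMurthy2012_lemma71_key
  refine ⟨tripleProductProperty_of_mulClosed hS hS' hT hT' hU hU' ?_, h8, h7, h7'⟩
  intro a ha b hb c hc habc
  refine hkey b hb c hc ?_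
  have hinv : a⁻¹ = b * c := inv_eq_of_mul_eq_one_right (by rw [← mul_assoc]; exact habc)
  exact hshape _ (hinv ▸ inv_mem_of_exists_mul_eq_one hS' a ha)

/-- **Hedtke–Murthy 2012, Lemma 7.1 ("via a TPP triple of subgroups")**: `SL₃(𝔽₂)` has subgroups `H₁, H₂, H₃` of
orders `8, 7, 7` (the upper unitriangular matrices, `⟨t₀⟩`, `⟨u₀⟩`) with the subgroup triple product property
`h₁ h₂ h₃ = 1 ⇒ h₁ = h₂ = h₃ = 1`. [cite: HedtkeMurthy2012, Lemma 7.1] -/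
theorem HedtkeMurthy2012_lemma71_subgroups :
    ∃ H₁ H₂ H₃ : Subgroup SL(3, ZMod 2), Nat.card H₁ = 8 ∧ Nat.card H₂ = 7 ∧ Nat.card H₃ = 7 ∧ SubgroupTPP H₁ H₂ H₃ := by
  obtain ⟨h8, h1S, hS, hS', hshape⟩ := facts_S
  obtain ⟨h7, h1T, hT, hT'⟩ := facts_T
  obtain ⟨h7', h1U, hU, hU'⟩ := facts_U
  have hkey := HedtkeMurthy2012_lemma71_key
  obtain ⟨H₁, H₂, H₃, e₁, e₂, e₃, htpp⟩ :=
    exists_subgroupTPP_of_mulClosed h1S hS hS' h1T hT hT' h1U hU hU' (by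
      intro a ha b hb c hc habc
      refine hkey b hb c hc ?_
      have hinv : a⁻¹ = b * c := inv_eq_of_mul_eq_one_right (by rw [← mul_assoc]; exact habc)
      exact hshape _ (hinv ▸ inv_mem_of_exists_mul_eq_one hS' a ha))
  have card_eq : ∀ (H : Subgroup SL(3, ZMod 2)) (X : Finset SL(3, ZMod 2)), (H : Set SL(3, ZMod 2)) = X → Nat.card H = X.card := by
    intro H X e
    rw [← SetLike.coe_sort_coe, e, Finset.coe_sort_coe, Nat.card_eq_fintype_card, Fintype.card_coe]
  exact ⟨H₁, H₂, H₃, (card_eq _ _ e₁).trans h8, (card_eq _ _ e₂).trans h7, (card_eq _ _ e₃).trans h7', htpp⟩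

/-- **Hedtke–Murthy 2012, Lemma 7.1**: `SL₃(𝔽₂)` realizes `⟨8, 7, 7⟩`; `|SL₃(𝔽₂)| = 168`, so the realized volume
`8·7·7 = 392` is `(7/3)·|SL₃(𝔽₂)|` ("`β(SL₃𝔽₂) ≥ 392 = (7/3)|SL₃𝔽₂|`"). [cite: HedtkeMurthy2012, Lemma 7.1] -/
theorem HedtkeMurthy2012_lemma71 :
    RealizesTPP SL(3, ZMod 2) 8 7 7 ∧ Nat.card SL(3, ZMod 2) = 168 ∧ 3 * (8 * 7 * 7) = 7 * Nat.card SL(3, ZMod 2) := by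
  have hc : Nat.card SL(3, ZMod 2) = 168 := by rw [Nat.card_eq_fintype_card]; exact card_SL3F2
  obtain ⟨htpp, h8, h7, h7'⟩ := HedtkeMurthy2012_lemma71_triple
  exact ⟨⟨_, _, _, h8, h7, h7', htpp⟩, hc, by rw [hc]⟩

end SL3F2

end Literature.Computability.AlgebraicComplexity
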